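import Literature.Geometry.GeometricMeasureTheory.Currents
import Literature.Geometry.GeometricMeasureTheory.CurrentsConstancy
import Mathlib.MeasureTheory.Measure.Support
import Mathlib.MeasureTheory.Measure.Haar.Unique
import Mathlib.Geometry.Euclidean.Volume.Measure
import HarnessLib

/-!
# Translation-invariant measures with a lower density bound: dimension, sheets

Support file for the proof of the named fact
`Literature.Geometry.GeometricMeasureTheory.Federer1969_compactness_integralCurrents` along
B. White's structure-theorem-free proof of the closure theorem [White1989]: the structure of the
blow-up measure. After the constant vectorfield lemma, the blow-up `ν` of `‖T‖` at a good point is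
a locally finite measure invariant under the translations of a linear subspace `W`, and (by the
lower density bound transported to the blow-up) `ν 𝐁(y, r) ≥ c rᵐ` for every `y ∈ spt ν` and all
small `r`. This file proves, for such `ν` [White1989, p. 213; Bandara2006, Lemmas 4.1.9–4.1.10 and
the proof of Thm. 4.2.1, pp. 41–42]:

* `Measure.add_mem_support_of_map_add_eq_self` — `spt ν` is `W`-invariant, and
  `Measure.starProjection_orthogonal_mem_support` — the `Wᗮ`-component of a point of `spt ν` lies
  in `spt ν`;
* `card_mul_pow_mul_le_measure_closedBall` — **the packing estimate**: for `2ρ`-separated points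
  `z ∈ spt ν ∩ Wᗮ` in `𝐁(0, R)` and an orthonormal `d`-frame of `W`, the `#Z · Kᵈ` balls of radius
  `ρ` centred at `z + Σᵢ 2ρ κᵢ fᵢ` (`κ ∈ {0,…,K-1}ᵈ`) are disjoint, lie in `𝐁(0, R + 2ρKd + ρ)` and
  each has mass `≥ c (ρ/2)ᵐ`;
* **`Measure.finrank_le_of_map_add_eq_self`** — "translation invariant in at most `m` directions":
  `ν ≠ 0 ⟹ dim W ≤ m` (Bandara Lemma 4.1.9: "exactly n directions", the upper bound);
* **`Measure.finite_support_inter_orthogonal_inter_closedBall`** — if `dim W = m`, the set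
  `spt ν ∩ Wᗮ` of sheets is locally finite (Bandara Lemma 4.1.10: "`𝒫` is finite");
* **`Measure.restrict_slab_eq_smul_hausdorffMeasure`** — **each isolated sheet is a constant
  multiple of `m`-dimensional measure on its plane**: if `z ∈ Wᗮ` and `spt ν ∩ Wᗮ ∩ B(z, δ) ⊆ {z}`
  then `ν ⌞ {x : P_{Wᗮ} x ∈ B(z, δ)} = α • 𝓗ᵐ ⌞ (z + W)` with `α = addHaarScalarFactor … < ∞`
  (push forward to `W`, uniqueness of Haar measure on `W`, pull back along the isometry
  `w ↦ z + w`; Bandara: "`μ ⌞ P = α 𝓗ⁿ ⌞ P` for `α` a constant", via [Mat95, 3.4]), and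
  `Measure.smul_hausdorffMeasure_slab_pos` — `α > 0` when `z ∈ spt ν`.

Theorems only; no new definitions, no named facts.

## References

* B. White, *A new proof of the compactness theorem for integral currents*, Comment. Math.
  Helv. 64 (1989) 207–220, p. 213 [White1989].
* L. Bandara, *The closure theorem for integral currents without the structure theorem*,
  B.Sc. thesis, ANU 2006, Lemmas 4.1.9, 4.1.10, proof of Thm. 4.2.1 (held copy
  `lit paper:galaxy-pdf-8023002039701172160`, PDF pp. 36–37, 41–42) [Bandara2006].
* P. Mattila, *Geometry of Sets and Measures in Euclidean Spaces*, CUP 1995, Thm. 3.4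
  [Mattila1995].
-/

noncomputable section

open scoped ENNReal NNReal Topology RealInnerProductSpace Pointwise
open MeasureTheory MeasureTheory.Measure TopologicalSpace Set Filter Metric Function

namespace Literature.Geometry.GeometricMeasureTheory

variable {V : Type*} [NormedAddCommGroup V] [InnerProductSpace ℝ V] [FiniteDimensional ℝ V]
  [MeasurableSpace V] [BorelSpace V]

/-! ### Invariance of the support -/

section Support

omit [InnerProductSpace ℝ V] [FiniteDimensional ℝ V] in
/-- For a `w`-invariant measure, balls at `y` and at `y + w` have the same mass.
[cite: Bandara2006, Lemma 4.1.9] -/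
theorem Measure.measure_ball_add_eq_of_map_add_eq_self {ν : Measure V} {w : V}
    (hinv : ν.map (· + w) = ν) (y : V) (r : ℝ) : ν (ball (y + w) r) = ν (ball y r) := by
  conv_lhs => rw [← hinv]
  rw [Measure.map_apply (measurable_add_const w) measurableSet_ball]
  congr 1
  ext x
  simp [mem_ball, dist_eq_norm]

omit [InnerProductSpace ℝ V] [FiniteDimensional ℝ V] in
/-- For a `w`-invariant measure, closed balls at `y` and at `y + w` have the same mass.
[cite: Bandara2006, Lemma 4.1.9] -/
theorem Measure.measure_closedBall_add_eq_of_map_add_eq_self {ν : Measure V} {w : V}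
    (hinv : ν.map (· + w) = ν) (y : V) (r : ℝ) : ν (closedBall (y + w) r) = ν (closedBall y r) := by
  conv_lhs => rw [← hinv]
  rw [Measure.map_apply (measurable_add_const w) measurableSet_closedBall]
  congr 1
  ext x
  simp [mem_closedBall, dist_eq_norm]

omit [InnerProductSpace ℝ V] [FiniteDimensional ℝ V] in
/-- **The support of a `w`-invariant measure is `w`-invariant.** [cite: Bandara2006, Lemma 4.1.9] -/
theorem Measure.add_mem_support_of_map_add_eq_self {ν : Measure V} {w : V}
    (hinv : ν.map (· + w) = ν) {y : V} (hy : y ∈ ν.support) : y + w ∈ ν.support := by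
  rw [Metric.nhds_basis_ball.mem_measureSupport] at hy ⊢
  intro r hr
  rw [Measure.measure_ball_add_eq_of_map_add_eq_self hinv]
  exact hy r hr

/-- **The `Wᗮ`-component of a point of the support of a `W`-invariant measure lies in the
support** (`spt ν = W + (spt ν ∩ Wᗮ)`). [cite: Bandara2006, Lemma 4.1.10] -/
theorem Measure.starProjection_orthogonal_mem_support {ν : Measure V} {W : Submodule ℝ V}
    (hinv : ∀ w ∈ W, ν.map (· + w) = ν) {y : V} (hy : y ∈ ν.support) :
    Wᗮ.starProjection y ∈ ν.support := by
  have h : Wᗮ.starProjection y = y + (-(W.starProjection y)) := by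
    rw [Submodule.starProjection_orthogonal_val]; abel
  rw [h]
  exact Measure.add_mem_support_of_map_add_eq_self
    (hinv _ (W.neg_mem (W.starProjection_apply_mem y))) hy

end Support

/-! ### The packing estimate -/

section Packing

variable {W : Submodule ℝ V} {d : ℕ} {f : Fin d → V}

omit [FiniteDimensional ℝ V] [MeasurableSpace V] [BorelSpace V] in
/-- The grid vectors `Σᵢ 2ρ κᵢ fᵢ` lie in `W`. [folklore] -/
private theorem grid_mem (hfW : ∀ i, f i ∈ W) (ρ : ℝ) {K : ℕ} (κ : Fin d → Fin K) :
    ∑ i, (2 * ρ * ((κ i : ℕ) : ℝ)) • f i ∈ W :=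
  Submodule.sum_mem _ fun i _ => Submodule.smul_mem _ _ (hfW i)

omit [FiniteDimensional ℝ V] [MeasurableSpace V] [BorelSpace V] in
/-- The grid vectors have norm `≤ 2ρ K d`. [folklore] -/
private theorem norm_grid_le (hf : Orthonormal ℝ f) {ρ : ℝ} (hρ : 0 ≤ ρ) {K : ℕ} (κ : Fin d → Fin K) :
    ‖∑ i, (2 * ρ * ((κ i : ℕ) : ℝ)) • f i‖ ≤ 2 * ρ * K * d := by
  refine (norm_sum_le _ _).trans ?_
  have hterm : ∀ i ∈ Finset.univ, ‖(2 * ρ * ((κ i : ℕ) : ℝ)) • f i‖ ≤ 2 * ρ * K := by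
    intro i _
    rw [norm_smul, hf.1 i, mul_one, Real.norm_eq_abs, abs_of_nonneg (by positivity)]
    gcongr
    exact_mod_cast (κ i).2.le
  refine (Finset.sum_le_sum hterm).trans ?_
  rw [Finset.sum_const, Finset.card_univ, Fintype.card_fin, nsmul_eq_mul]
  linarith [show (d : ℝ) * (2 * ρ * K) = 2 * ρ * K * d by ring]

omit [FiniteDimensional ℝ V] [MeasurableSpace V] [BorelSpace V] in
/-- Distinct grid vectors are `2ρ` apart (compare the coordinate along an `fᵢ` where the
multi-indices differ). [folklore] -/
private theorem le_dist_grid (hf : Orthonormal ℝ f) {ρ : ℝ} (hρ : 0 ≤ ρ) {K : ℕ} {κ κ' : Fin d → Fin K}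
    (h : κ ≠ κ') :
    2 * ρ ≤ dist (∑ i, (2 * ρ * ((κ i : ℕ) : ℝ)) • f i) (∑ i, (2 * ρ * ((κ' i : ℕ) : ℝ)) • f i) := by
  obtain ⟨i, hi⟩ := Function.ne_iff.1 h
  rw [dist_eq_norm, ← Finset.sum_sub_distrib]
  simp_rw [← sub_smul]
  set x := ∑ j, (2 * ρ * ((κ j : ℕ) : ℝ) - 2 * ρ * ((κ' j : ℕ) : ℝ)) • f j with hx
  have hinner : ⟪x, f i⟫ = 2 * ρ * ((κ i : ℕ) : ℝ) - 2 * ρ * ((κ' i : ℕ) : ℝ) := by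
    rw [hx, hf.inner_left_fintype]; simp
  have hci : (1 : ℝ) ≤ |((κ i : ℕ) : ℝ) - ((κ' i : ℕ) : ℝ)| := by
    have hne : ((κ i : ℕ) : ℤ) ≠ ((κ' i : ℕ) : ℤ) := by
      intro h'; exact hi (Fin.ext (by exact_mod_cast h'))
    have h1 : (1 : ℤ) ≤ |((κ i : ℕ) : ℤ) - ((κ' i : ℕ) : ℤ)| := Int.one_le_abs (sub_ne_zero.2 hne)
    have h2 : (((1 : ℤ) : ℝ)) ≤ ((|((κ i : ℕ) : ℤ) - ((κ' i : ℕ) : ℤ)| : ℤ) : ℝ) := by exact_mod_cast h1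
    simpa [Int.cast_abs, Int.cast_sub] using h2
  calc 2 * ρ = 2 * ρ * 1 := by ring
    _ ≤ 2 * ρ * |((κ i : ℕ) : ℝ) - ((κ' i : ℕ) : ℝ)| := by gcongr
    _ = |⟪x, f i⟫| := by rw [hinner, ← mul_sub, abs_mul, abs_of_nonneg (by positivity : (0 : ℝ) ≤ 2 * ρ)]
    _ ≤ ‖x‖ * ‖f i‖ := abs_real_inner_le_norm _ _
    _ = ‖x‖ := by rw [hf.1 i, mul_one]

omit [FiniteDimensional ℝ V] in
/-- **The packing estimate.** Let `ν` be a measure whose support is `W`-invariant and which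
satisfies the lower bound `ν 𝐁(y, r) ≥ c rᵐ` for `y ∈ spt ν`, `0 < r ≤ r₀`. For an orthonormal
`d`-frame `f` of `W`, a finite `2ρ`-separated set `Z ⊆ spt ν ∩ Wᗮ ∩ 𝐁(0, R)` (`0 < ρ ≤ r₀`) and
`K ∈ ℕ`, the balls `B(z + Σᵢ 2ρκᵢfᵢ, ρ)`, `z ∈ Z`, `κ ∈ {0, …, K-1}ᵈ`, are pairwise disjoint,
contained in `𝐁(0, R + 2ρKd + ρ)`, centred on `spt ν`, so
`#Z · Kᵈ · c (ρ/2)ᵐ ≤ ν 𝐁(0, R + 2ρKd + ρ)`. [cite: Bandara2006, Lemma 4.1.10] -/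
theorem card_mul_pow_mul_le_measure_closedBall {ν : Measure V} {m : ℕ} {c : ℝ≥0∞} {r₀ : ℝ}
    (hsupp : ∀ y ∈ ν.support, ∀ w ∈ W, y + w ∈ ν.support)
    (hld : ∀ y ∈ ν.support, ∀ r : ℝ, 0 < r → r ≤ r₀ →
      c * ENNReal.ofReal (r ^ m) ≤ ν (closedBall y r))
    (hf : Orthonormal ℝ f) (hfW : ∀ i, f i ∈ W) (Z : Finset V) (hZW : ∀ z ∈ Z, z ∈ Wᗮ)
    (hZs : ∀ z ∈ Z, z ∈ ν.support) {ρ : ℝ} (hρ : 0 < ρ) (hρr : ρ ≤ r₀)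
    (hsep : ∀ z ∈ Z, ∀ z' ∈ Z, z ≠ z' → 2 * ρ ≤ dist z z') (K : ℕ) {R : ℝ}
    (hR : ∀ z ∈ Z, ‖z‖ ≤ R) :
    (Z.card : ℝ≥0∞) * (K : ℝ≥0∞) ^ d * (c * ENNReal.ofReal ((ρ / 2) ^ m)) ≤
      ν (closedBall 0 (R + 2 * ρ * K * d + ρ)) := by
  classical
  -- centres and balls
  set g : (Fin d → Fin K) → V := fun κ => ∑ i, (2 * ρ * ((κ i : ℕ) : ℝ)) • f i with hg
  set ctr : V × (Fin d → Fin K) → V := fun p => p.1 + g p.2 with hctr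
  set I : Finset (V × (Fin d → Fin K)) := Z ×ˢ Finset.univ with hI
  -- pairwise disjointness
  have hdisj : (I : Set (V × (Fin d → Fin K))).PairwiseDisjoint fun p => ball (ctr p) ρ := by
    intro p hp q hq hpq
    have hp1 : p.1 ∈ Z := (Finset.mem_product.1 hp).1
    have hq1 : q.1 ∈ Z := (Finset.mem_product.1 hq).1
    refine ball_disjoint_ball ?_
    rw [← two_mul]
    -- `dist (ctr p) (ctr q) ≥ 2ρ`
    have hdec : ctr p - ctr q = (p.1 - q.1) + (g p.2 - g q.2) := by
      simp only [hctr]; abel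
    have horth : ⟪p.1 - q.1, g p.2 - g q.2⟫ = 0 :=
      Submodule.inner_left_of_mem_orthogonal
        (W.sub_mem (grid_mem hfW ρ p.2) (grid_mem hfW ρ q.2))
        (Wᗮ.sub_mem (hZW _ hp1) (hZW _ hq1))
    have hsq : ‖ctr p - ctr q‖ * ‖ctr p - ctr q‖ =
        ‖p.1 - q.1‖ * ‖p.1 - q.1‖ + ‖g p.2 - g q.2‖ * ‖g p.2 - g q.2‖ := by
      rw [hdec]
      exact norm_add_sq_eq_norm_sq_add_norm_sq_real horth
    rw [dist_eq_norm]
    by_cases h1 : p.1 = q.1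
    · have h2 : p.2 ≠ q.2 := fun h2 => hpq (Prod.ext h1 h2)
      have hle : ‖g p.2 - g q.2‖ ≤ ‖ctr p - ctr q‖ :=
        (sq_le_sq₀ (norm_nonneg _) (norm_nonneg _)).1
          (by rw [sq, sq, hsq]; nlinarith [mul_self_nonneg ‖p.1 - q.1‖])
      have := le_dist_grid hf hρ.le h2
      rw [dist_eq_norm] at this
      exact this.trans hle
    · have hle : ‖p.1 - q.1‖ ≤ ‖ctr p - ctr q‖ :=
        (sq_le_sq₀ (norm_nonneg _) (norm_nonneg _)).1
          (by rw [sq, sq, hsq]; nlinarith [mul_self_nonneg ‖g p.2 - g q.2‖])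
      have := hsep _ hp1 _ hq1 h1
      rw [dist_eq_norm] at this
      exact this.trans hle
  -- containment in the big ball
  have hsub : ∀ p ∈ I, ball (ctr p) ρ ⊆ closedBall (0 : V) (R + 2 * ρ * K * d + ρ) := by
    intro p hp x hx
    have hp1 : p.1 ∈ Z := (Finset.mem_product.1 hp).1
    rw [mem_closedBall, dist_zero_right]
    rw [mem_ball, dist_eq_norm] at hx
    calc ‖x‖ = ‖(x - ctr p) + (p.1 + g p.2)‖ := by simp [hctr]
      _ ≤ ‖x - ctr p‖ + (‖p.1‖ + ‖g p.2‖) := (norm_add_le _ _).trans (by gcongr; exact norm_add_le _ _)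
      _ ≤ ρ + (R + 2 * ρ * K * d) :=
          add_le_add hx.le (add_le_add (hR _ hp1) (norm_grid_le hf hρ.le p.2))
      _ = R + 2 * ρ * K * d + ρ := by ring
  -- each ball has mass `≥ c (ρ/2)^m`
  have hmass : ∀ p ∈ I, c * ENNReal.ofReal ((ρ / 2) ^ m) ≤ ν (ball (ctr p) ρ) := by
    intro p hp
    have hp1 : p.1 ∈ Z := (Finset.mem_product.1 hp).1
    have hctr_mem : ctr p ∈ ν.support := hsupp _ (hZs _ hp1) _ (grid_mem hfW ρ p.2)
    refine (hld _ hctr_mem (ρ / 2) (by positivity) (by linarith)).trans (measure_mono ?_)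
    exact closedBall_subset_ball (by linarith)
  -- sum up
  calc (Z.card : ℝ≥0∞) * (K : ℝ≥0∞) ^ d * (c * ENNReal.ofReal ((ρ / 2) ^ m))
      = ∑ p ∈ I, c * ENNReal.ofReal ((ρ / 2) ^ m) := by
        simp only [Finset.sum_const, hI, Finset.card_product, Finset.card_univ, Fintype.card_fun,
          Fintype.card_fin, nsmul_eq_mul]
        push_cast
        ring
    _ ≤ ∑ p ∈ I, ν (ball (ctr p) ρ) := Finset.sum_le_sum hmass
    _ = ν (⋃ p ∈ I, ball (ctr p) ρ) :=
        (measure_biUnion_finset hdisj fun p _ => measurableSet_ball).symm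
    _ ≤ ν (closedBall 0 (R + 2 * ρ * K * d + ρ)) :=
        measure_mono (iUnion₂_subset fun p hp => hsub p hp)

end Packing

/-! ### Dimension bound and local finiteness of the sheets -/

section Sheets

variable {W : Submodule ℝ V} {ν : Measure V} {m : ℕ} {c : ℝ≥0∞} {r₀ : ℝ}

/-- **Translation invariance in at most `m` directions** [Bandara2006, Lemma 4.1.9: "`μ ∧ τ(a)`
is translation invariant in exactly `n` directions" — the upper bound]: a non-zero locally finite
measure, invariant under the subspace `W` and with `ν 𝐁(y, r) ≥ c rᵐ` (`c > 0`) for `y ∈ spt ν`,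
`0 < r ≤ r₀`, has `dim W ≤ m` (otherwise the packing estimate with `ρ = r₀ / K` puts
`≍ K^{dim W - m} → ∞` mass in a fixed ball). [cite: Bandara2006, Lemma 4.1.9; White1989, p. 213] -/
theorem Measure.finrank_le_of_map_add_eq_self [IsLocallyFiniteMeasure ν]
    (hinv : ∀ w ∈ W, ν.map (· + w) = ν) (hν : ν ≠ 0) (hc : c ≠ 0) (hr₀ : 0 < r₀)
    (hld : ∀ y ∈ ν.support, ∀ r : ℝ, 0 < r → r ≤ r₀ →
      c * ENNReal.ofReal (r ^ m) ≤ ν (closedBall y r)) :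
    Module.finrank ℝ W ≤ m := by
  by_contra hlt
  rw [not_le] at hlt
  set d := Module.finrank ℝ W with hd
  -- a point of the support in `Wᗮ`
  obtain ⟨y, hy⟩ := Measure.nonempty_support hν
  set z := Wᗮ.starProjection y with hz
  have hzs : z ∈ ν.support := Measure.starProjection_orthogonal_mem_support hinv hy
  have hzW : z ∈ Wᗮ := Wᗮ.starProjection_apply_mem y
  -- an orthonormal frame of `W`
  set e := stdOrthonormalBasis ℝ W with he
  set f : Fin d → V := fun i => (e i : V) with hf
  have hfon : Orthonormal ℝ f := e.orthonormal.comp_linearIsometry W.subtypeₗᵢ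
  have hfW : ∀ i, f i ∈ W := fun i => (e i).2
  have hsupp : ∀ y ∈ ν.support, ∀ w ∈ W, y + w ∈ ν.support := fun y hy w hw =>
    Measure.add_mem_support_of_map_add_eq_self (hinv w hw) hy
  -- the fixed ball and its finite mass
  set R := ‖z‖ + 2 * r₀ * d + r₀ with hR
  have hfin : ν (closedBall 0 R) < ⊤ := (isCompact_closedBall _ _).measure_lt_top
  -- the packing estimate with `ρ = r₀ / K`
  have hpack : ∀ K : ℕ, 0 < K →
      (K : ℝ≥0∞) ^ d * (c * ENNReal.ofReal ((r₀ / K / 2) ^ m)) ≤ ν (closedBall 0 R) := by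
    intro K hK
    have hK' : (0 : ℝ) < K := by exact_mod_cast hK
    have h := card_mul_pow_mul_le_measure_closedBall hsupp hld hfon hfW {z}
      (fun z' hz' => by rw [Finset.mem_singleton.1 hz']; exact hzW)
      (fun z' hz' => by rw [Finset.mem_singleton.1 hz']; exact hzs)
      (ρ := r₀ / K) (by positivity) (div_le_self hr₀.le (by exact_mod_cast hK))
      (fun a ha b hb hab => (hab ((Finset.mem_singleton.1 ha).trans
        (Finset.mem_singleton.1 hb).symm)).elim) K (R := ‖z‖)
      (fun z' hz' => by rw [Finset.mem_singleton.1 hz'])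
    rw [Finset.card_singleton, Nat.cast_one, one_mul] at h
    refine h.trans (measure_mono (closedBall_subset_closedBall ?_))
    rw [hR]
    have : 2 * (r₀ / K) * K * d = 2 * r₀ * d := by field_simp
    rw [this]
    gcongr
    exact div_le_self hr₀.le (by exact_mod_cast hK)
  -- `K · c (r₀/2)^m ≤ K^d · c (r₀/(2K))^m ≤ ν 𝐁(0, R)` for all `K ≥ 1`: contradiction
  have hpos : c * ENNReal.ofReal ((r₀ / 2) ^ m) ≠ 0 :=
    (ENNReal.mul_pos hc (ENNReal.ofReal_pos.2 (by positivity)).ne').ne'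
  obtain ⟨n, hn⟩ := ENNReal.exists_nat_mul_gt hpos hfin.ne
  have hn0 : 0 < n := by
    rcases Nat.eq_zero_or_pos n with h | h
    · rw [h, Nat.cast_zero, zero_mul] at hn; exact (ENNReal.not_lt_zero hn).elim
    · exact h
  have hreal : (n : ℝ) * (r₀ / 2) ^ m ≤ (n : ℝ) ^ d * (r₀ / n / 2) ^ m := by
    have hn1 : (1 : ℝ) ≤ n := by exact_mod_cast hn0
    have hsplit : (r₀ / n / 2) ^ m = (r₀ / 2) ^ m / (n : ℝ) ^ m := by
      rw [div_div, mul_comm, ← div_div, div_pow]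
    rw [hsplit, mul_div_assoc', le_div_iff₀ (by positivity)]
    calc (n : ℝ) * (r₀ / 2) ^ m * (n : ℝ) ^ m = (n : ℝ) ^ (m + 1) * (r₀ / 2) ^ m := by ring
      _ ≤ (n : ℝ) ^ d * (r₀ / 2) ^ m :=
          mul_le_mul_of_nonneg_right (pow_le_pow_right₀ hn1 (by omega)) (by positivity)
  have hE : (n : ℝ≥0∞) * (c * ENNReal.ofReal ((r₀ / 2) ^ m)) ≤
      (n : ℝ≥0∞) ^ d * (c * ENNReal.ofReal ((r₀ / n / 2) ^ m)) := by
    calc (n : ℝ≥0∞) * (c * ENNReal.ofReal ((r₀ / 2) ^ m))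
        = c * ENNReal.ofReal ((n : ℝ) * (r₀ / 2) ^ m) := by
          rw [ENNReal.ofReal_mul (by positivity), ENNReal.ofReal_natCast]; ring
      _ ≤ c * ENNReal.ofReal ((n : ℝ) ^ d * (r₀ / n / 2) ^ m) := by
          gcongr
      _ = (n : ℝ≥0∞) ^ d * (c * ENNReal.ofReal ((r₀ / n / 2) ^ m)) := by
          rw [ENNReal.ofReal_mul (by positivity), ENNReal.ofReal_pow (by positivity),
            ENNReal.ofReal_natCast]; ring
  exact (lt_irrefl _) ((hE.trans (hpack n hn0)).trans_lt hn)

omit [InnerProductSpace ℝ V] [FiniteDimensional ℝ V] [MeasurableSpace V] [BorelSpace V] in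
/-- A finite set of points has a positive separation `2ρ ≤ dist z z'` (`z ≠ z'`) with `ρ ≤ r₀`.
[folklore] -/
private theorem exists_sep (Z : Finset V) {r₀ : ℝ} (hr₀ : 0 < r₀) :
    ∃ ρ : ℝ, 0 < ρ ∧ ρ ≤ r₀ ∧ ∀ z ∈ Z, ∀ z' ∈ Z, z ≠ z' → 2 * ρ ≤ dist z z' := by
  classical
  set D := ((Z ×ˢ Z).filter fun p : V × V => p.1 ≠ p.2).image fun p => dist p.1 p.2 with hD
  have hmemD : ∀ z ∈ Z, ∀ z' ∈ Z, z ≠ z' → dist z z' ∈ D := fun z hz z' hz' hne =>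
    Finset.mem_image.2 ⟨(z, z'), Finset.mem_filter.2 ⟨Finset.mem_product.2 ⟨hz, hz'⟩, hne⟩, rfl⟩
  by_cases hne : D.Nonempty
  · have hδ : 0 < D.min' hne := by
      obtain ⟨p, hp, hpeq⟩ := Finset.mem_image.1 (D.min'_mem hne)
      rw [← hpeq]
      exact dist_pos.2 (Finset.mem_filter.1 hp).2
    refine ⟨min r₀ (D.min' hne / 2), lt_min hr₀ (by linarith), min_le_left _ _,
      fun z hz z' hz' h => ?_⟩
    calc 2 * min r₀ (D.min' hne / 2) ≤ 2 * (D.min' hne / 2) := by gcongr; exact min_le_right _ _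
      _ = D.min' hne := by ring
      _ ≤ dist z z' := D.min'_le _ (hmemD z hz z' hz' h)
  · exact ⟨r₀, hr₀, le_rfl, fun z hz z' hz' h => (hne ⟨_, hmemD z hz z' hz' h⟩).elim⟩

/-- **The sheets are locally finite** [Bandara2006, Lemma 4.1.10: "`𝒫` is finite"]: if `ν` is
locally finite, `W`-invariant with `dim W = m` and `ν 𝐁(y, r) ≥ c rᵐ` (`c > 0`) on its support for
`0 < r ≤ r₀`, then `spt ν ∩ Wᗮ` meets every ball in a finite set (for `N` sheets within `𝐁(0,R)`
the packing estimate gives `N · c (r₀/2)ᵐ ≤ ν 𝐁(0, R + 4 r₀ m + r₀)`).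
[cite: Bandara2006, Lemma 4.1.10; White1989, p. 213] -/
theorem Measure.finite_support_inter_orthogonal_inter_closedBall [IsLocallyFiniteMeasure ν]
    (hinv : ∀ w ∈ W, ν.map (· + w) = ν) (hc : c ≠ 0) (hr₀ : 0 < r₀)
    (hld : ∀ y ∈ ν.support, ∀ r : ℝ, 0 < r → r ≤ r₀ →
      c * ENNReal.ofReal (r ^ m) ≤ ν (closedBall y r))
    (hdim : Module.finrank ℝ W = m) (R : ℝ) :
    (ν.support ∩ (Wᗮ : Set V) ∩ closedBall 0 R).Finite := by
  classical
  by_contra hinf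
  -- an orthonormal frame of `W`
  set e := stdOrthonormalBasis ℝ W with he
  set f : Fin (Module.finrank ℝ W) → V := fun i => (e i : V) with hf
  have hfon : Orthonormal ℝ f := e.orthonormal.comp_linearIsometry W.subtypeₗᵢ
  have hfW : ∀ i, f i ∈ W := fun i => (e i).2
  have hsupp : ∀ y ∈ ν.support, ∀ w ∈ W, y + w ∈ ν.support := fun y hy w hw =>
    Measure.add_mem_support_of_map_add_eq_self (hinv w hw) hy
  -- the fixed ball and its finite mass
  set R' := R + 4 * r₀ * m + r₀ with hR'
  have hfin : ν (closedBall 0 R') < ⊤ := (isCompact_closedBall _ _).measure_lt_top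
  have hpos : c * ENNReal.ofReal ((r₀ / 2) ^ m) ≠ 0 :=
    (ENNReal.mul_pos hc (ENNReal.ofReal_pos.2 (by positivity)).ne').ne'
  obtain ⟨n, hn⟩ := ENNReal.exists_nat_mul_gt hpos hfin.ne
  -- `n` sheets in the ball
  obtain ⟨Z, hZsub, hZcard⟩ := Set.Infinite.exists_subset_card_eq hinf n
  have hZs : ∀ z ∈ Z, z ∈ ν.support := fun z hz => (hZsub (Finset.mem_coe.2 hz)).1.1
  have hZW : ∀ z ∈ Z, z ∈ Wᗮ := fun z hz => (hZsub (Finset.mem_coe.2 hz)).1.2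
  have hZR : ∀ z ∈ Z, ‖z‖ ≤ R := fun z hz => by
    have := (hZsub (Finset.mem_coe.2 hz)).2
    rwa [mem_closedBall, dist_zero_right] at this
  obtain ⟨ρ, hρ, hρr, hsep⟩ := exists_sep Z hr₀
  -- `K` with `K ρ ≥ r₀` and `2ρK m ≤ 4 r₀ m`
  set K : ℕ := ⌈r₀ / ρ⌉₊ with hK
  have hKge : r₀ ≤ K * ρ := by
    rw [hK]
    have := Nat.le_ceil (r₀ / ρ)
    rwa [div_le_iff₀ hρ] at this
  have hKle : (K : ℝ) * ρ ≤ r₀ + ρ := by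
    rw [hK]
    have := (Nat.ceil_lt_add_one (div_nonneg hr₀.le hρ.le)).le
    calc (⌈r₀ / ρ⌉₊ : ℝ) * ρ ≤ (r₀ / ρ + 1) * ρ := by gcongr
      _ = r₀ + ρ := by field_simp
  have hpack := card_mul_pow_mul_le_measure_closedBall hsupp hld hfon hfW Z hZW hZs hρ hρr hsep K hZR
  rw [hZcard, hdim] at hpack
  -- compare
  have hreal : (n : ℝ) * (r₀ / 2) ^ m ≤ (n : ℝ) * ((K : ℝ) ^ m * (ρ / 2) ^ m) := by
    gcongr
    rw [← mul_pow]
    gcongr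
    linarith
  have hE : (n : ℝ≥0∞) * (c * ENNReal.ofReal ((r₀ / 2) ^ m)) ≤
      (n : ℝ≥0∞) * (K : ℝ≥0∞) ^ m * (c * ENNReal.ofReal ((ρ / 2) ^ m)) := by
    calc (n : ℝ≥0∞) * (c * ENNReal.ofReal ((r₀ / 2) ^ m))
        = c * ENNReal.ofReal ((n : ℝ) * (r₀ / 2) ^ m) := by
          rw [ENNReal.ofReal_mul (by positivity), ENNReal.ofReal_natCast]; ring
      _ ≤ c * ENNReal.ofReal ((n : ℝ) * ((K : ℝ) ^ m * (ρ / 2) ^ m)) := by gcongr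
      _ = (n : ℝ≥0∞) * (K : ℝ≥0∞) ^ m * (c * ENNReal.ofReal ((ρ / 2) ^ m)) := by
          rw [ENNReal.ofReal_mul (by positivity), ENNReal.ofReal_mul (by positivity),
            ENNReal.ofReal_pow (by positivity), ENNReal.ofReal_natCast, ENNReal.ofReal_natCast]
          ring
  have hball : ν (closedBall 0 (R + 2 * ρ * K * m + ρ)) ≤ ν (closedBall 0 R') := by
    refine measure_mono (closedBall_subset_closedBall ?_)
    rw [hR']
    have : 2 * ρ * K * m ≤ 4 * r₀ * m := by
      have hm : (0 : ℝ) ≤ m := Nat.cast_nonneg m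
      nlinarith [mul_comm (K : ℝ) ρ]
    linarith
  exact (lt_irrefl _) (((hE.trans hpack).trans hball).trans_lt hn)

/-- **Each sheet is isolated**: under the same hypotheses, every `z ∈ spt ν ∩ Wᗮ` has a
neighbourhood containing no other point of `spt ν ∩ Wᗮ`. [cite: Bandara2006, Lemma 4.1.10] -/
theorem Measure.exists_isolated_of_mem_support_inter_orthogonal [IsLocallyFiniteMeasure ν]
    (hinv : ∀ w ∈ W, ν.map (· + w) = ν) (hc : c ≠ 0) (hr₀ : 0 < r₀)
    (hld : ∀ y ∈ ν.support, ∀ r : ℝ, 0 < r → r ≤ r₀ →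
      c * ENNReal.ofReal (r ^ m) ≤ ν (closedBall y r))
    (hdim : Module.finrank ℝ W = m) (z : V) :
    ∃ δ : ℝ, 0 < δ ∧ ∀ z' ∈ ν.support, z' ∈ Wᗮ → dist z' z < δ → z' = z := by
  classical
  have hfin := Measure.finite_support_inter_orthogonal_inter_closedBall hinv hc hr₀ hld hdim (‖z‖ + 1)
  set F := hfin.toFinset.erase z with hF
  obtain ⟨ρ, hρ, -, hsep⟩ := exists_sep (insert z F) one_pos
  refine ⟨min 1 ρ, lt_min one_pos hρ, fun z' hz' hz'W hdist => ?_⟩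
  by_contra hne
  have hz'F : z' ∈ F := by
    rw [hF, Finset.mem_erase]
    refine ⟨hne, hfin.mem_toFinset.2 ⟨⟨hz', hz'W⟩, ?_⟩⟩
    rw [mem_closedBall, dist_zero_right]
    calc ‖z'‖ = ‖(z' - z) + z‖ := by rw [sub_add_cancel]
      _ ≤ ‖z' - z‖ + ‖z‖ := norm_add_le _ _
      _ ≤ 1 + ‖z‖ := by
          rw [← dist_eq_norm]; gcongr; exact (hdist.trans_le (min_le_left _ _)).le
      _ = ‖z‖ + 1 := add_comm _ _
  have h2 := hsep z' (Finset.mem_insert_of_mem hz'F) z (Finset.mem_insert_self _ _) hne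
  linarith [hdist.trans_le (min_le_right 1 ρ), dist_nonneg (x := z') (y := z)]

end Sheets

/-! ### The structure of an isolated sheet -/

section Slab

variable {W : Submodule ℝ V} {ν : Measure V}

omit [MeasurableSpace V] [BorelSpace V] in
/-- The slab `{x : dist (P_{Wᗮ} x, z) < δ}` is invariant under `W`. [folklore] -/
private theorem preimage_add_slab {w : V} (hw : w ∈ W) (z : V) (δ : ℝ) :
    (fun x : V => x + w) ⁻¹' {x | dist (Wᗮ.starProjection x) z < δ} =
      {x | dist (Wᗮ.starProjection x) z < δ} := by
  ext x
  have hw0 : Wᗮ.starProjection w = 0 :=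
    (Submodule.starProjection_apply_eq_zero_iff Wᗮ).2 (Submodule.le_orthogonal_orthogonal W hw)
  simp only [mem_preimage, mem_setOf_eq, map_add, hw0, add_zero]

/-- The slab is measurable (open). [folklore] -/
private theorem measurableSet_slab (z : V) (δ : ℝ) :
    MeasurableSet {x : V | dist (Wᗮ.starProjection x) z < δ} :=
  (isOpen_lt (Wᗮ.starProjection.continuous.dist continuous_const) continuous_const).measurableSet

/-- **The restriction of a `W`-invariant measure to a `W`-invariant slab is `W`-invariant.**
[cite: Bandara2006, Lemma 4.1.9] -/
theorem Measure.map_add_restrict_slab_eq {w : V} (hw : w ∈ W) (hinv : ν.map (· + w) = ν) (z : V)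
    (δ : ℝ) :
    (ν.restrict {x | dist (Wᗮ.starProjection x) z < δ}).map (· + w) =
      ν.restrict {x | dist (Wᗮ.starProjection x) z < δ} := by
  have hSm := measurableSet_slab (W := W) z δ
  ext A hA
  rw [Measure.map_apply (measurable_add_const w) hA,
    Measure.restrict_apply (measurable_add_const w hA), Measure.restrict_apply hA]
  conv_rhs => rw [← hinv, Measure.map_apply (measurable_add_const w) (hA.inter hSm)]
  rw [Set.preimage_inter, preimage_add_slab hw]

/-- **An isolated sheet of a `W`-invariant measure is a constant multiple of `dim W`-dimensional
measure on its plane** [Bandara2006, proof of Thm. 4.2.1, p. 42: "`μ ⌞ P = α 𝓗ⁿ ⌞ P` for `α` a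
constant", via uniformly distributed measures [Mat95, 3.4]; here via uniqueness of Haar measure
on `W`]: if `ν` is locally finite and `W`-invariant, `z ∈ Wᗮ`, and the only point of
`spt ν ∩ Wᗮ` within `δ` of `z` is `z` itself, then on the slab `S = {x : dist(P_{Wᗮ} x, z) < δ}`
one has `ν ⌞ S = α • μHE[dim W] ⌞ (z + W)` for a constant `α ∈ ℝ≥0`.
[cite: Bandara2006, Thm. 4.2.1 (proof); Mattila1995, Thm. 3.4] -/
theorem Measure.exists_restrict_slab_eq_smul [IsLocallyFiniteMeasure ν]
    (hinv : ∀ w ∈ W, ν.map (· + w) = ν) {z : V} (hzW : z ∈ Wᗮ) {δ : ℝ}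
    (hiso : ∀ z' ∈ ν.support, z' ∈ Wᗮ → dist z' z < δ → z' = z) :
    ∃ α : ℝ≥0, ν.restrict {x | dist (Wᗮ.starProjection x) z < δ} =
      (α : ℝ≥0∞) • (μHE[Module.finrank ℝ W] : Measure V).restrict {x | x - z ∈ W} := by
  set S := {x : V | dist (Wᗮ.starProjection x) z < δ} with hS
  set A := {x : V | x - z ∈ W} with hA
  have hSm : MeasurableSet S := measurableSet_slab z δ
  -- (a) `ν ⌞ S` is concentrated on the plane `A = z + W`
  have hconc : ∀ᵐ x ∂(ν.restrict S), x ∈ A := by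
    rw [ae_restrict_iff' hSm]
    filter_upwards [show ∀ᵐ x ∂ν, x ∈ ν.support from Measure.support_mem_ae] with x hx hxS
    have hQ : Wᗮ.starProjection x = z :=
      hiso _ (Measure.starProjection_orthogonal_mem_support hinv hx)
        (Wᗮ.starProjection_apply_mem x) hxS
    rw [Submodule.starProjection_orthogonal_val] at hQ
    show x - z ∈ W
    rw [show x - z = W.starProjection x by rw [← hQ]; abel]
    exact W.starProjection_apply_mem x
  -- (b) push forward to `W`
  set P' : V →L[ℝ] W := W.orthogonalProjectionOnto with hP'
  have hP'm : Measurable P' := P'.continuous.measurable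
  set μW : Measure W := (ν.restrict S).map P' with hμW
  haveI : IsAddLeftInvariant μW := by
    refine ⟨fun w => ?_⟩
    have hcomp : (fun x : W => w + x) ∘ P' = P' ∘ fun x : V => x + (w : V) := by
      funext x
      simp only [comp_apply, map_add, hP', Submodule.orthogonalProjectionOnto_mem_subspace_eq_self,
        add_comm]
    have hinvS := Measure.map_add_restrict_slab_eq (ν := ν) w.2 (hinv w w.2) z δ
    rw [hμW, Measure.map_map (measurable_const_add w) hP'm, hcomp,
      ← Measure.map_map hP'm (measurable_add_const _)]
    exact congr_arg (Measure.map P') hinvS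
  haveI : IsFiniteMeasureOnCompacts μW := by
    refine ⟨fun K' hK' => ?_⟩
    rw [hμW, Measure.map_apply hP'm hK'.measurableSet,
      Measure.restrict_apply (hK'.measurableSet.preimage hP'm)]
    obtain ⟨RK, hRK⟩ := hK'.isBounded.subset_closedBall 0
    refine (measure_mono ?_).trans_lt ((isCompact_closedBall (0 : V) (RK + (δ + ‖z‖))).measure_lt_top)
    rintro x ⟨hxK, hxS⟩
    rw [mem_closedBall, dist_zero_right]
    have h1 : ‖W.starProjection x‖ ≤ RK := by
      rw [Submodule.starProjection_apply, Submodule.norm_coe]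
      have := hRK hxK
      rwa [mem_closedBall, dist_zero_right] at this
    have h2 : ‖Wᗮ.starProjection x‖ ≤ δ + ‖z‖ := by
      rw [hS, mem_setOf_eq, dist_eq_norm] at hxS
      calc ‖Wᗮ.starProjection x‖ = ‖(Wᗮ.starProjection x - z) + z‖ := by rw [sub_add_cancel]
        _ ≤ ‖Wᗮ.starProjection x - z‖ + ‖z‖ := norm_add_le _ _
        _ ≤ δ + ‖z‖ := by gcongr
    calc ‖x‖ = ‖W.starProjection x + Wᗮ.starProjection x‖ := by
          rw [Submodule.starProjection_add_starProjection_orthogonal]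
      _ ≤ ‖W.starProjection x‖ + ‖Wᗮ.starProjection x‖ := norm_add_le _ _
      _ ≤ RK + (δ + ‖z‖) := add_le_add h1 h2
  -- (c) uniqueness of Haar measure on `W`
  have hHaar := Measure.isAddLeftInvariant_eq_smul μW (μHE[Module.finrank ℝ W] : Measure W)
  set α := μW.addHaarScalarFactor (μHE[Module.finrank ℝ W] : Measure W) with hα
  refine ⟨α, ?_⟩
  -- (d) pull back along the isometry `ι w = z + w`
  set ι : W → V := ZeroGradient.planeEmb W z with hι
  have hιiso : Isometry ι := ZeroGradient.isometry_planeEmb W z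
  have hιm : Measurable ι := hιiso.continuous.measurable
  have hrange : range ι = A := ZeroGradient.range_planeEmb W z
  have hae : (fun x : V => x) =ᵐ[ν.restrict S] (ι ∘ P') := by
    filter_upwards [hconc] with x hx
    have hz0 : W.starProjection z = 0 := (Submodule.starProjection_apply_eq_zero_iff W).2 hzW
    have hPx : (P' x : V) = x - z := by
      rw [hP', ← Submodule.starProjection_apply,
        show x = (x - z) + z by rw [sub_add_cancel], map_add, hz0, add_zero, add_sub_cancel_right,
        Submodule.starProjection_eq_self_iff]
      exact hx
    show x = z + (P' x : V)
    rw [hPx, add_sub_cancel]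
  have hsmul : (α • (μHE[Module.finrank ℝ W] : Measure W)) =
      (α : ℝ≥0∞) • (μHE[Module.finrank ℝ W] : Measure W) := by
    rfl
  calc ν.restrict S = (ν.restrict S).map (fun x => x) := Measure.map_id'.symm
    _ = (ν.restrict S).map (ι ∘ P') := Measure.map_congr hae
    _ = ((ν.restrict S).map P').map ι := (Measure.map_map hιm hP'm).symm
    _ = (α • (μHE[Module.finrank ℝ W] : Measure W)).map ι := by rw [← hμW, ← hHaar]
    _ = (α : ℝ≥0∞) • ((μHE[Module.finrank ℝ W] : Measure W).map ι) := by
        rw [hsmul, Measure.map_smul]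
    _ = (α : ℝ≥0∞) • (μHE[Module.finrank ℝ W] : Measure V).restrict A := by
        rw [hιiso.map_euclideanHausdorffMeasure, hrange]

omit [MeasurableSpace V] [BorelSpace V] in
/-- The ball `B(z, δ)` lies in the slab `{dist(P_{Wᗮ} x, z) < δ}` when `z ∈ Wᗮ` (the projection
is `1`-Lipschitz and fixes `z`). [folklore] -/
private theorem ball_subset_slab {z : V} (hzW : z ∈ Wᗮ) (δ : ℝ) :
    ball z δ ⊆ {x : V | dist (Wᗮ.starProjection x) z < δ} := by
  intro x hx
  rw [mem_setOf_eq, dist_eq_norm]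
  rw [mem_ball, dist_eq_norm] at hx
  have hz : Wᗮ.starProjection z = z := Submodule.starProjection_eq_self_iff.2 hzW
  calc ‖Wᗮ.starProjection x - z‖ = ‖Wᗮ.starProjection (x - z)‖ := by rw [map_sub, hz]
    _ ≤ ‖x - z‖ := Wᗮ.norm_starProjection_apply_le (x - z)
    _ < δ := hx

/-- **The sheet constant is positive at a point of the support**: in the situation of
`Measure.exists_restrict_slab_eq_smul`, if moreover `z ∈ spt ν` and `δ > 0` then `α ≠ 0`.
[cite: Bandara2006, Thm. 4.2.1 (proof)] -/
theorem Measure.smul_restrict_slab_ne_zero {z : V} (hz : z ∈ ν.support) (hzW : z ∈ Wᗮ) {δ : ℝ}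
    (hδ : 0 < δ) {α : ℝ≥0} {d : ℕ}
    (h : ν.restrict {x | dist (Wᗮ.starProjection x) z < δ} =
      (α : ℝ≥0∞) • (μHE[d] : Measure V).restrict {x | x - z ∈ W}) : α ≠ 0 := by
  intro hα
  have hpos : 0 < ν (ball z δ) := (Metric.nhds_basis_ball.mem_measureSupport.1 hz) δ hδ
  have h1 : ν.restrict {x | dist (Wᗮ.starProjection x) z < δ} (ball z δ) = ν (ball z δ) := by
    rw [Measure.restrict_apply measurableSet_ball,
      inter_eq_self_of_subset_left (ball_subset_slab hzW δ)]
  rw [← h1, h, hα] at hpos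
  simp at hpos

end Slab



end Literature.Geometry.GeometricMeasureTheory
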